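import Summits.CriticalPhenomena.PercolationContinuityZ3.Theorems.PercNearOneGluingNoHeavyConstsClusterSquareClusterSeparated
import HarnessLib

/-!
# No double clash under the LINKED criterion: cluster-wise separations with a common cut vertex

builds on p205010 (kernel theorem, internal audit signed; external expert review pending)

PAPER-2 track "percolation constants", part (ii), seat `prim-consts-1`, gen 17 (lane index
`run/shared/lean/prim/consts/CONSTANTS.md`, row A19; memo `FROM-prim-consts-1-g17-THREE-COPY-STRUCTURE.md` §2b).
Support file for the crux `NoHeavyLowerTail` (stmt-CriticalPhenomena-4575; `--supports`).  Theorems only; no sorries.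

Refines `Consts.not_doubleClash_of_clusterSeparated` by the DISJOINTNESS of the two sides: in a double clash with cluster
`K = C_a(ω)`, clash vertices `y, y'` and branch vertices `v, v'` (`Consts.exists_branch_of_clash'`), the `ω`-objects on the `b`-side —
the initial segment `y → v` of the clash path and any `ω`-path `v → b` — lie in `C_b(ω)`, those on the `c`-side (`y' → v'`, `v' → c`)
lie in `C_c(ω)`, and `C_b(ω) ∩ C_c(ω) = ∅`; likewise the `η'`-paths `v → c ⊆ C_c(η')` and `v' → b ⊆ C_b(η')` are disjoint.  Hence, besides
the six single separations of `…ClusterSeparated`, a pair `(K, y, y', v, v')` is also refuted by a COMMON CUT VERTEX `z`: two closed-set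
certificates showing that every admissible realisation of one `b`-side object and every admissible realisation of one `c`-side object
(of the same configuration) pass through `z` (`Consts.not_doubleClash_of_linked`; five such pairings).  CSQ, DUU at `(a; b, c)` and TS
for `{a, b, c}` follow (`Consts.clusterSquare_le_sq_of_linked`, `Consts.sq_real_split_le_of_linked`, `Consts.tripleSplit_of_linked`).
Census (lane engine `eng/crit10_census.py`, exact enumeration; combined with the near-pendant contractions of `…ClusterSquarePendant`):
the criterion coincides with NDC on every rooted graph tested — all 21 840 on ≤ 5 vertices, the six-vertex sample (6 519 NDC-true,
681 false) and a sparse seven-vertex sample (2 424 / 201) — and covers 670 of 720 NDC-true rooted graphs of a dense seven-vertex sample;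
it is never satisfied when NDC fails.
Reference: N. Gladkov, arXiv:2408.08457v2 (2024), Thm. 4.3, Def. 4.2, Lemma 3.1, Example 2.5, Thm. 5.2.
-/

noncomputable section

open Classical

namespace Summit.CriticalPhenomena.PercolationContinuityZ3.Theorems

open MeasureTheory Finset Literature.Probability.LatticeModels Literature.Probability.Percolation
open Literature.Probability.Percolation.DecisionTree Literature.Probability.Percolation.BHK2006
open Literature.Probability.Percolation.TargetExploration Literature.Probability.Percolation.ClusterConditioning

namespace Consts

section General

variable {V : Type*} [Fintype V]

/-- **No double clash under the linked criterion.**  As `Consts.not_doubleClash_of_clusterSeparated`, with five further ways to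
refute a configuration `(K, y, y', v, v')`: a vertex `z` and two closed sets certifying that `z` lies on every admissible realisation
of a `b`-side object (`y → v` off `K ∪ {b, c, v', y'}` or `v → b` off `K ∪ {c, v', y'}`) AND of a `c`-side object (`y' → v'` off
`K ∪ {b, c, v, y}` or `v' → c` off `K ∪ {b, v, y}`) of `ω`, or on every realisation of `v → c` off `K ∪ {b, v', y'}` AND of `v' → b`
off `K ∪ {c, v, y}` (the `η'`-side). [folklore; input for Gladkov2024, Thm. 4.3] -/
theorem not_doubleClash_of_linked (H : SimpleGraph V) [DecidableRel H.Adj] (w : Sym2 V → unitInterval) {a b c : V}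
    (hH : ∀ u v, u ≠ v → (0 : ℝ) < w s(u, v) → H.Adj u v)
    (hK : ∀ (K : Set V) (y y' v v' : V), a ∈ K → b ∉ K → c ∉ K →
      (∀ T : Set V, a ∈ T → (∀ u x, u ∈ T → H.Adj u x → x ∈ K → x ∈ T) → K ⊆ T) →
      y ∉ K → y' ∉ K → (∃ k, k ∈ K ∧ H.Adj k y) → (∃ k, k ∈ K ∧ H.Adj k y') →
      y ≠ a → y ≠ b → y ≠ c → y' ≠ a → y' ≠ b → y' ≠ c → y ≠ y' →
      v ∉ K → v' ∉ K → v ≠ a → v ≠ b → v ≠ c → v' ≠ a → v' ≠ b → v' ≠ c → v ≠ v' → v ≠ y' → v' ≠ y →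
      3 ≤ H.degree v → 3 ≤ H.degree v' →
      ∃ (S S' : Set V) (z : V),
        (v ∈ S ∧ b ∉ S ∧ ∀ u x, u ∈ S → H.Adj u x → x ∉ K → x ≠ c → x ≠ v' → x ≠ y' → x ∈ S) ∨
        (v ∈ S ∧ c ∉ S ∧ ∀ u x, u ∈ S → H.Adj u x → x ∉ K → x ≠ b → x ≠ v' → x ≠ y' → x ∈ S) ∨
        (v' ∈ S ∧ c ∉ S ∧ ∀ u x, u ∈ S → H.Adj u x → x ∉ K → x ≠ b → x ≠ v → x ≠ y → x ∈ S) ∨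
        (v' ∈ S ∧ b ∉ S ∧ ∀ u x, u ∈ S → H.Adj u x → x ∉ K → x ≠ c → x ≠ v → x ≠ y → x ∈ S) ∨
        (y ∈ S ∧ v ∉ S ∧ ∀ u x, u ∈ S → H.Adj u x → x ∉ K → x ≠ b → x ≠ c → x ≠ v' → x ≠ y' → x ∈ S) ∨
        (y' ∈ S ∧ v' ∉ S ∧ ∀ u x, u ∈ S → H.Adj u x → x ∉ K → x ≠ b → x ≠ c → x ≠ v → x ≠ y → x ∈ S) ∨
        ((v ∈ S ∧ b ∉ S ∧ ∀ u x, u ∈ S → H.Adj u x → x ∉ K → x ≠ c → x ≠ v' → x ≠ y' → x ≠ z → x ∈ S) ∧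
          (v' ∈ S' ∧ c ∉ S' ∧ ∀ u x, u ∈ S' → H.Adj u x → x ∉ K → x ≠ b → x ≠ v → x ≠ y → x ≠ z → x ∈ S')) ∨
        ((y ∈ S ∧ v ∉ S ∧ ∀ u x, u ∈ S → H.Adj u x → x ∉ K → x ≠ b → x ≠ c → x ≠ v' → x ≠ y' → x ≠ z → x ∈ S) ∧
          (v' ∈ S' ∧ c ∉ S' ∧ ∀ u x, u ∈ S' → H.Adj u x → x ∉ K → x ≠ b → x ≠ v → x ≠ y → x ≠ z → x ∈ S')) ∨
        ((v ∈ S ∧ b ∉ S ∧ ∀ u x, u ∈ S → H.Adj u x → x ∉ K → x ≠ c → x ≠ v' → x ≠ y' → x ≠ z → x ∈ S) ∧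
          (y' ∈ S' ∧ v' ∉ S' ∧ ∀ u x, u ∈ S' → H.Adj u x → x ∉ K → x ≠ b → x ≠ c → x ≠ v → x ≠ y → x ≠ z → x ∈ S')) ∨
        ((y ∈ S ∧ v ∉ S ∧ ∀ u x, u ∈ S → H.Adj u x → x ∉ K → x ≠ b → x ≠ c → x ≠ v' → x ≠ y' → x ≠ z → x ∈ S) ∧
          (y' ∈ S' ∧ v' ∉ S' ∧ ∀ u x, u ∈ S' → H.Adj u x → x ∉ K → x ≠ b → x ≠ c → x ≠ v → x ≠ y → x ≠ z → x ∈ S')) ∨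
        ((v ∈ S ∧ c ∉ S ∧ ∀ u x, u ∈ S → H.Adj u x → x ∉ K → x ≠ b → x ≠ v' → x ≠ y' → x ≠ z → x ∈ S) ∧
          (v' ∈ S' ∧ b ∉ S' ∧ ∀ u x, u ∈ S' → H.Adj u x → x ∉ K → x ≠ c → x ≠ v → x ≠ y → x ≠ z → x ∈ S')))
    {ω η : Set (Sym2 V)} (hω : ∀ e ∈ ω, (0 : ℝ) < w e) (hη : ∀ e ∈ η, (0 : ℝ) < w e)
    (hab : ¬ (openGraph ω).Reachable a b) (hac : ¬ (openGraph ω).Reachable a c) (hbc : ¬ (openGraph ω).Reachable b c)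
    (hbc' : ¬ (openGraph (η \ barOf {a} (setCl ω {a}))).Reachable b c) :
    ¬ ((∃ y k : V, (openGraph ω).Reachable a k ∧ (0 : ℝ) < w s(k, y) ∧ (openGraph ω).Reachable b y ∧
          (openGraph (η \ barOf {a} (setCl ω {a}))).Reachable c y) ∧
       (∃ y k : V, (openGraph ω).Reachable a k ∧ (0 : ℝ) < w s(k, y) ∧ (openGraph ω).Reachable c y ∧
          (openGraph (η \ barOf {a} (setCl ω {a}))).Reachable b y)) := by
  rintro ⟨⟨y, k, hk, hw, hby, hcy⟩, ⟨y', k', hk', hw', hcy', hby'⟩⟩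
  set θ := η \ barOf {a} (setCl ω {a}) with hθdef
  set K : Set V := {x | (openGraph ω).Reachable a x} with hKdef
  have hadjH : ∀ (ξ : Set (Sym2 V)), (∀ e ∈ ξ, (0 : ℝ) < w e) → ∀ u v, (openGraph ξ).Adj u v → H.Adj u v := by
    intro ξ hξ u v huv
    rw [openGraph_adj] at huv
    exact hH u v huv.2 (hξ _ huv.1)
  have hθ : ∀ e ∈ θ, (0 : ℝ) < w e := fun e he => hη e he.1
  have hθK : ∀ u v, (openGraph θ).Adj u v → ¬ (openGraph ω).Reachable a v := by
    intro u v huv hav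
    rw [openGraph_adj, hθdef, barOf_setCl_singleton_eq_cutSet] at huv
    exact huv.1.2 ⟨v, Sym2.mem_mk_right u v, hav⟩
  have hky : H.Adj k y := hH k y (fun h => hab (hk.trans (h ▸ hby.symm))) hw
  have hky' : H.Adj k' y' := hH k' y' (fun h => hac (hk'.trans (h ▸ hcy'.symm))) hw'
  obtain ⟨v, hva, hvb, hvc, hvK, hdv, hbv, hcv, ⟨W, hWb⟩⟩ := exists_branch_of_clash' H (hadjH ω hω) (hadjH _ hθ) hθK hab hbc hbc'
    hk hky hby hcy
  obtain ⟨v', hva', hvc', hvb', hvK', hdv', hcv', hbv', ⟨W', hWc⟩⟩ := exists_branch_of_clash' H (hadjH ω hω) (hadjH _ hθ) hθK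
    hac (fun h => hbc h.symm) (fun h => hbc' h.symm) hk' hky' hcy' hby'
  have hyK : y ∉ K := fun h => hab (h.trans hby.symm)
  have hyK' : y' ∉ K := fun h => hac (h.trans hcy'.symm)
  have hconn : ∀ T : Set V, a ∈ T → (∀ u x, u ∈ T → H.Adj u x → x ∈ K → x ∈ T) → K ⊆ T := by
    intro T haT hT x hx
    obtain ⟨X⟩ := id hx
    exact mem_of_openWalk_adm H T (fun z => z ∈ K) (fun u z hu huz hz => hT u z hu huz hz) (hadjH ω hω) X haT
      fun z hz => Or.inr (show (openGraph ω).Reachable a z from ⟨X.takeUntil z hz⟩)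
  have hωx : ∀ {s t : V} (X : (openGraph ω).Walk s t) (x : V), x ∈ X.support → (openGraph ω).Reachable s x :=
    fun X x hx => ⟨X.takeUntil x hx⟩
  have hθx : ∀ {s t : V} (X : (openGraph θ).Walk s t) (x : V), x ∈ X.support → (openGraph θ).Reachable s x :=
    fun X x hx => ⟨X.takeUntil x hx⟩
  -- what membership of the four clusters entails
  have hCb : ∀ x, (openGraph ω).Reachable b x → x ∉ K ∧ x ≠ c ∧ x ≠ v' ∧ x ≠ y' := fun x hbx =>
    ⟨fun h => hab (h.trans hbx.symm), fun h => hbc (by rw [← h]; exact hbx),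
      fun h => hbc (hbx.trans (by rw [h]; exact hcv'.symm)), fun h => hbc (hbx.trans (by rw [h]; exact hcy'.symm))⟩
  have hCc : ∀ x, (openGraph ω).Reachable c x → x ∉ K ∧ x ≠ b ∧ x ≠ v ∧ x ≠ y := fun x hcx =>
    ⟨fun h => hac (h.trans hcx.symm), fun h => hbc (by rw [← h]; exact hcx.symm),
      fun h => hbc (hbv.trans (by rw [← h]; exact hcx.symm)), fun h => hbc (hby.trans (by rw [← h]; exact hcx.symm))⟩
  have hθnotK : ∀ s x, ¬ (openGraph ω).Reachable a s → (openGraph θ).Reachable s x → ¬ (openGraph ω).Reachable a x :=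
    fun s x hs ⟨X⟩ => not_reachable_of_mem_support a hθK X hs x X.end_mem_support
  have hCcθ : ∀ x, (openGraph θ).Reachable c x → x ∉ K ∧ x ≠ b ∧ x ≠ v' ∧ x ≠ y' := fun x hcx =>
    ⟨hθnotK c x hac hcx, fun h => hbc' (by rw [← h]; exact hcx.symm),
      fun h => hbc' (hbv'.trans (by rw [← h]; exact hcx.symm)), fun h => hbc' (hby'.trans (by rw [← h]; exact hcx.symm))⟩
  have hCbθ : ∀ x, (openGraph θ).Reachable b x → x ∉ K ∧ x ≠ c ∧ x ≠ v ∧ x ≠ y := fun x hbx =>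
    ⟨hθnotK b x hab hbx, fun h => hbc' (by rw [← h]; exact hbx),
      fun h => hbc' (hbx.trans (by rw [h]; exact hcv.symm)), fun h => hbc' (hbx.trans (by rw [h]; exact hcy.symm))⟩
  -- the six objects as walks
  obtain ⟨X₁⟩ := hbv.symm   -- `ω`: v → b, inside `C_b(ω)`
  obtain ⟨X₂⟩ := hcv.symm   -- `θ`: v → c, inside `C_c(θ)`
  obtain ⟨X₃⟩ := hcv'.symm  -- `ω`: v' → c, inside `C_c(ω)`
  obtain ⟨X₄⟩ := hbv'.symm  -- `θ`: v' → b, inside `C_b(θ)`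
  have hX₁ : ∀ x ∈ X₁.support, (openGraph ω).Reachable b x := fun x hx => hbv.trans (hωx X₁ x hx)
  have hX₂ : ∀ x ∈ X₂.support, (openGraph θ).Reachable c x := fun x hx => hcv.trans (hθx X₂ x hx)
  have hX₃ : ∀ x ∈ X₃.support, (openGraph ω).Reachable c x := fun x hx => hcv'.trans (hωx X₃ x hx)
  have hX₄ : ∀ x ∈ X₄.support, (openGraph θ).Reachable b x := fun x hx => hbv'.trans (hθx X₄ x hx)
  have hW : ∀ x ∈ W.support, (openGraph ω).Reachable b x ∧ x ≠ b := fun x hx =>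
    ⟨hby.trans (hωx W x hx), fun h => hWb (h ▸ hx)⟩
  have hW' : ∀ x ∈ W'.support, (openGraph ω).Reachable c x ∧ x ≠ c := fun x hx =>
    ⟨hcy'.trans (hωx W' x hx), fun h => hWc (h ▸ hx)⟩
  -- generic refutations of the six objects, with an optional extra forbidden vertex `z` known to be off the walk
  have r1 : ∀ (S : Set V) (z : V), v ∈ S → b ∉ S →
      (∀ u x, u ∈ S → H.Adj u x → x ∉ K → x ≠ c → x ≠ v' → x ≠ y' → x ≠ z → x ∈ S) → z ∉ X₁.support → False :=
    fun S z hvS hbS hcl hz => hbS (mem_of_openWalk_adm H S (fun x => x ∉ K ∧ x ≠ c ∧ x ≠ v' ∧ x ≠ y' ∧ x ≠ z)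
      (fun u x hu hux hx => hcl u x hu hux hx.1 hx.2.1 hx.2.2.1 hx.2.2.2.1 hx.2.2.2.2) (hadjH ω hω) X₁ hvS
      fun x hx => Or.inr ⟨(hCb x (hX₁ x hx)).1, (hCb x (hX₁ x hx)).2.1, (hCb x (hX₁ x hx)).2.2.1, (hCb x (hX₁ x hx)).2.2.2,
        fun h => hz (h ▸ hx)⟩)
  have r2 : ∀ (S : Set V) (z : V), v ∈ S → c ∉ S →
      (∀ u x, u ∈ S → H.Adj u x → x ∉ K → x ≠ b → x ≠ v' → x ≠ y' → x ≠ z → x ∈ S) → z ∉ X₂.support → False :=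
    fun S z hvS hcS hcl hz => hcS (mem_of_openWalk_adm H S (fun x => x ∉ K ∧ x ≠ b ∧ x ≠ v' ∧ x ≠ y' ∧ x ≠ z)
      (fun u x hu hux hx => hcl u x hu hux hx.1 hx.2.1 hx.2.2.1 hx.2.2.2.1 hx.2.2.2.2) (hadjH _ hθ) X₂ hvS
      fun x hx => Or.inr ⟨(hCcθ x (hX₂ x hx)).1, (hCcθ x (hX₂ x hx)).2.1, (hCcθ x (hX₂ x hx)).2.2.1, (hCcθ x (hX₂ x hx)).2.2.2,
        fun h => hz (h ▸ hx)⟩)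
  have r3 : ∀ (S : Set V) (z : V), v' ∈ S → c ∉ S →
      (∀ u x, u ∈ S → H.Adj u x → x ∉ K → x ≠ b → x ≠ v → x ≠ y → x ≠ z → x ∈ S) → z ∉ X₃.support → False :=
    fun S z hvS hcS hcl hz => hcS (mem_of_openWalk_adm H S (fun x => x ∉ K ∧ x ≠ b ∧ x ≠ v ∧ x ≠ y ∧ x ≠ z)
      (fun u x hu hux hx => hcl u x hu hux hx.1 hx.2.1 hx.2.2.1 hx.2.2.2.1 hx.2.2.2.2) (hadjH ω hω) X₃ hvS
      fun x hx => Or.inr ⟨(hCc x (hX₃ x hx)).1, (hCc x (hX₃ x hx)).2.1, (hCc x (hX₃ x hx)).2.2.1, (hCc x (hX₃ x hx)).2.2.2,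
        fun h => hz (h ▸ hx)⟩)
  have r4 : ∀ (S : Set V) (z : V), v' ∈ S → b ∉ S →
      (∀ u x, u ∈ S → H.Adj u x → x ∉ K → x ≠ c → x ≠ v → x ≠ y → x ≠ z → x ∈ S) → z ∉ X₄.support → False :=
    fun S z hvS hbS hcl hz => hbS (mem_of_openWalk_adm H S (fun x => x ∉ K ∧ x ≠ c ∧ x ≠ v ∧ x ≠ y ∧ x ≠ z)
      (fun u x hu hux hx => hcl u x hu hux hx.1 hx.2.1 hx.2.2.1 hx.2.2.2.1 hx.2.2.2.2) (hadjH _ hθ) X₄ hvS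
      fun x hx => Or.inr ⟨(hCbθ x (hX₄ x hx)).1, (hCbθ x (hX₄ x hx)).2.1, (hCbθ x (hX₄ x hx)).2.2.1, (hCbθ x (hX₄ x hx)).2.2.2,
        fun h => hz (h ▸ hx)⟩)
  have r5 : ∀ (S : Set V) (z : V), y ∈ S → v ∉ S →
      (∀ u x, u ∈ S → H.Adj u x → x ∉ K → x ≠ b → x ≠ c → x ≠ v' → x ≠ y' → x ≠ z → x ∈ S) → z ∉ W.support → False :=
    fun S z hyS hvS hcl hz => hvS (mem_of_openWalk_adm H S (fun x => x ∉ K ∧ x ≠ b ∧ x ≠ c ∧ x ≠ v' ∧ x ≠ y' ∧ x ≠ z)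
      (fun u x hu hux hx => hcl u x hu hux hx.1 hx.2.1 hx.2.2.1 hx.2.2.2.1 hx.2.2.2.2.1 hx.2.2.2.2.2) (hadjH ω hω) W hyS
      fun x hx => Or.inr ⟨(hCb x (hW x hx).1).1, (hW x hx).2, (hCb x (hW x hx).1).2.1, (hCb x (hW x hx).1).2.2.1,
        (hCb x (hW x hx).1).2.2.2, fun h => hz (h ▸ hx)⟩)
  have r6 : ∀ (S : Set V) (z : V), y' ∈ S → v' ∉ S →
      (∀ u x, u ∈ S → H.Adj u x → x ∉ K → x ≠ b → x ≠ c → x ≠ v → x ≠ y → x ≠ z → x ∈ S) → z ∉ W'.support → False :=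
    fun S z hyS hvS hcl hz => hvS (mem_of_openWalk_adm H S (fun x => x ∉ K ∧ x ≠ b ∧ x ≠ c ∧ x ≠ v ∧ x ≠ y ∧ x ≠ z)
      (fun u x hu hux hx => hcl u x hu hux hx.1 hx.2.1 hx.2.2.1 hx.2.2.2.1 hx.2.2.2.2.1 hx.2.2.2.2.2) (hadjH ω hω) W' hyS
      fun x hx => Or.inr ⟨(hCc x (hW' x hx).1).1, (hCc x (hW' x hx).1).2.1, (hW' x hx).2, (hCc x (hW' x hx).1).2.2.1,
        (hCc x (hW' x hx).1).2.2.2, fun h => hz (h ▸ hx)⟩)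
  -- disjointness facts: a vertex on a `b`-side `ω`-object is not on a `c`-side `ω`-object, etc.
  have dj13 : ∀ z, z ∈ X₁.support → z ∉ X₃.support := fun z h1 h3 => hbc ((hX₁ z h1).trans (hX₃ z h3).symm)
  have dj53 : ∀ z, z ∈ W.support → z ∉ X₃.support := fun z h1 h3 => hbc ((hW z h1).1.trans (hX₃ z h3).symm)
  have dj16 : ∀ z, z ∈ X₁.support → z ∉ W'.support := fun z h1 h3 => hbc ((hX₁ z h1).trans (hW' z h3).1.symm)
  have dj56 : ∀ z, z ∈ W.support → z ∉ W'.support := fun z h1 h3 => hbc ((hW z h1).1.trans (hW' z h3).1.symm)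
  have dj24 : ∀ z, z ∈ X₂.support → z ∉ X₄.support := fun z h2 h4 => hbc' ((hX₄ z h4).trans (hX₂ z h2).symm)
  obtain ⟨S, S', z, hS⟩ := hK K y y' v v' (SimpleGraph.Reachable.refl a) hab hac hconn hyK hyK' ⟨k, hk, hky⟩ ⟨k', hk', hky'⟩
    (fun h => hyK (by rw [h]; exact SimpleGraph.Reachable.refl a)) (fun h => hbc' (by rw [← h]; exact hcy.symm))
    (fun h => hbc (by rw [← h]; exact hby)) (fun h => hyK' (by rw [h]; exact SimpleGraph.Reachable.refl a))
    (fun h => hbc (by rw [← h]; exact hcy'.symm)) (fun h => hbc' (by rw [← h]; exact hby'))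
    (fun h => hbc (hby.trans (by rw [h]; exact hcy'.symm))) hvK hvK' hva hvb hvc hva' hvb' hvc'
    (fun h => hbc (hbv.trans (by rw [h]; exact hcv'.symm))) (fun h => hbc (hbv.trans (by rw [h]; exact hcy'.symm)))
    (fun h => hbc (hby.trans (by rw [← h]; exact hcv'.symm))) hdv hdv'
  -- a vertex off a given walk: `a` lies on none of the six walks (all avoid `K ∋ a`)
  have haK : a ∈ K := SimpleGraph.Reachable.refl a
  have ha1 : a ∉ X₁.support := fun h => (hCb a (hX₁ a h)).1 haK
  have ha2 : a ∉ X₂.support := fun h => (hCcθ a (hX₂ a h)).1 haK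
  have ha3 : a ∉ X₃.support := fun h => (hCc a (hX₃ a h)).1 haK
  have ha4 : a ∉ X₄.support := fun h => (hCbθ a (hX₄ a h)).1 haK
  have ha5 : a ∉ W.support := fun h => (hCb a (hW a h).1).1 haK
  have ha6 : a ∉ W'.support := fun h => (hCc a (hW' a h).1).1 haK
  rcases hS with ⟨h1, h2, hcl⟩ | ⟨h1, h2, hcl⟩ | ⟨h1, h2, hcl⟩ | ⟨h1, h2, hcl⟩ | ⟨h1, h2, hcl⟩ | ⟨h1, h2, hcl⟩ |
      ⟨⟨h1, h2, hcl⟩, ⟨h1', h2', hcl'⟩⟩ | ⟨⟨h1, h2, hcl⟩, ⟨h1', h2', hcl'⟩⟩ | ⟨⟨h1, h2, hcl⟩, ⟨h1', h2', hcl'⟩⟩ |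
      ⟨⟨h1, h2, hcl⟩, ⟨h1', h2', hcl'⟩⟩ | ⟨⟨h1, h2, hcl⟩, ⟨h1', h2', hcl'⟩⟩
  · exact r1 S a h1 h2 (fun u x hu hux h₁ h₂ h₃ h₄ _ => hcl u x hu hux h₁ h₂ h₃ h₄) ha1
  · exact r2 S a h1 h2 (fun u x hu hux h₁ h₂ h₃ h₄ _ => hcl u x hu hux h₁ h₂ h₃ h₄) ha2
  · exact r3 S a h1 h2 (fun u x hu hux h₁ h₂ h₃ h₄ _ => hcl u x hu hux h₁ h₂ h₃ h₄) ha3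
  · exact r4 S a h1 h2 (fun u x hu hux h₁ h₂ h₃ h₄ _ => hcl u x hu hux h₁ h₂ h₃ h₄) ha4
  · exact r5 S a h1 h2 (fun u x hu hux h₁ h₂ h₃ h₄ h₅ _ => hcl u x hu hux h₁ h₂ h₃ h₄ h₅) ha5
  · exact r6 S a h1 h2 (fun u x hu hux h₁ h₂ h₃ h₄ h₅ _ => hcl u x hu hux h₁ h₂ h₃ h₄ h₅) ha6
  · -- `v → b` and `v' → c` (both `ω`) through a common `z`
    by_cases hz : z ∈ X₁.support
    · exact r3 S' z h1' h2' hcl' (dj13 z hz)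
    · exact r1 S z h1 h2 hcl hz
  · -- `y → v` and `v' → c` through a common `z`
    by_cases hz : z ∈ W.support
    · exact r3 S' z h1' h2' hcl' (dj53 z hz)
    · exact r5 S z h1 h2 hcl hz
  · -- `v → b` and `y' → v'` through a common `z`
    by_cases hz : z ∈ X₁.support
    · exact r6 S' z h1' h2' hcl' (dj16 z hz)
    · exact r1 S z h1 h2 hcl hz
  · -- `y → v` and `y' → v'` through a common `z`
    by_cases hz : z ∈ W.support
    · exact r6 S' z h1' h2' hcl' (dj56 z hz)
    · exact r5 S z h1 h2 hcl hz
  · -- `v → c` and `v' → b` (both `η'`) through a common `z`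
    by_cases hz : z ∈ X₂.support
    · exact r4 S' z h1' h2' hcl' (dj24 z hz)
    · exact r2 S z h1 h2 hcl hz

end General

/-! ### `Fin n` forms -/

section Fin

variable {n : ℕ} (w : Sym2 (Fin n) → unitInterval) (a b c : Fin n) (H : SimpleGraph (Fin n)) [DecidableRel H.Adj]

/-- **CSQ at `(a; b, c)` under the linked criterion** (hypotheses as in `Consts.not_doubleClash_of_linked`):
`clusterSquare w a b c ≤ μ(b ↮ c)²`. [cite: Gladkov2024, Thm. 4.3, Def. 4.2, Lemma 3.1, Ex. 2.5] -/
theorem clusterSquare_le_sq_of_linked (hH : ∀ u v, u ≠ v → (0 : ℝ) < w s(u, v) → H.Adj u v)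
    (hK : ∀ (K : Set (Fin n)) (y y' v v' : Fin n), a ∈ K → b ∉ K → c ∉ K →
      (∀ T : Set (Fin n), a ∈ T → (∀ u x, u ∈ T → H.Adj u x → x ∈ K → x ∈ T) → K ⊆ T) →
      y ∉ K → y' ∉ K → (∃ k, k ∈ K ∧ H.Adj k y) → (∃ k, k ∈ K ∧ H.Adj k y') →
      y ≠ a → y ≠ b → y ≠ c → y' ≠ a → y' ≠ b → y' ≠ c → y ≠ y' →
      v ∉ K → v' ∉ K → v ≠ a → v ≠ b → v ≠ c → v' ≠ a → v' ≠ b → v' ≠ c → v ≠ v' → v ≠ y' → v' ≠ y →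
      3 ≤ H.degree v → 3 ≤ H.degree v' →
      ∃ (S S' : Set (Fin n)) (z : Fin n),
        (v ∈ S ∧ b ∉ S ∧ ∀ u x, u ∈ S → H.Adj u x → x ∉ K → x ≠ c → x ≠ v' → x ≠ y' → x ∈ S) ∨
        (v ∈ S ∧ c ∉ S ∧ ∀ u x, u ∈ S → H.Adj u x → x ∉ K → x ≠ b → x ≠ v' → x ≠ y' → x ∈ S) ∨
        (v' ∈ S ∧ c ∉ S ∧ ∀ u x, u ∈ S → H.Adj u x → x ∉ K → x ≠ b → x ≠ v → x ≠ y → x ∈ S) ∨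
        (v' ∈ S ∧ b ∉ S ∧ ∀ u x, u ∈ S → H.Adj u x → x ∉ K → x ≠ c → x ≠ v → x ≠ y → x ∈ S) ∨
        (y ∈ S ∧ v ∉ S ∧ ∀ u x, u ∈ S → H.Adj u x → x ∉ K → x ≠ b → x ≠ c → x ≠ v' → x ≠ y' → x ∈ S) ∨
        (y' ∈ S ∧ v' ∉ S ∧ ∀ u x, u ∈ S → H.Adj u x → x ∉ K → x ≠ b → x ≠ c → x ≠ v → x ≠ y → x ∈ S) ∨
        ((v ∈ S ∧ b ∉ S ∧ ∀ u x, u ∈ S → H.Adj u x → x ∉ K → x ≠ c → x ≠ v' → x ≠ y' → x ≠ z → x ∈ S) ∧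
          (v' ∈ S' ∧ c ∉ S' ∧ ∀ u x, u ∈ S' → H.Adj u x → x ∉ K → x ≠ b → x ≠ v → x ≠ y → x ≠ z → x ∈ S')) ∨
        ((y ∈ S ∧ v ∉ S ∧ ∀ u x, u ∈ S → H.Adj u x → x ∉ K → x ≠ b → x ≠ c → x ≠ v' → x ≠ y' → x ≠ z → x ∈ S) ∧
          (v' ∈ S' ∧ c ∉ S' ∧ ∀ u x, u ∈ S' → H.Adj u x → x ∉ K → x ≠ b → x ≠ v → x ≠ y → x ≠ z → x ∈ S')) ∨
        ((v ∈ S ∧ b ∉ S ∧ ∀ u x, u ∈ S → H.Adj u x → x ∉ K → x ≠ c → x ≠ v' → x ≠ y' → x ≠ z → x ∈ S) ∧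
          (y' ∈ S' ∧ v' ∉ S' ∧ ∀ u x, u ∈ S' → H.Adj u x → x ∉ K → x ≠ b → x ≠ c → x ≠ v → x ≠ y → x ≠ z → x ∈ S')) ∨
        ((y ∈ S ∧ v ∉ S ∧ ∀ u x, u ∈ S → H.Adj u x → x ∉ K → x ≠ b → x ≠ c → x ≠ v' → x ≠ y' → x ≠ z → x ∈ S) ∧
          (y' ∈ S' ∧ v' ∉ S' ∧ ∀ u x, u ∈ S' → H.Adj u x → x ∉ K → x ≠ b → x ≠ c → x ≠ v → x ≠ y → x ≠ z → x ∈ S')) ∨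
        ((v ∈ S ∧ c ∉ S ∧ ∀ u x, u ∈ S → H.Adj u x → x ∉ K → x ≠ b → x ≠ v' → x ≠ y' → x ≠ z → x ∈ S) ∧
          (v' ∈ S' ∧ b ∉ S' ∧ ∀ u x, u ∈ S' → H.Adj u x → x ∉ K → x ≠ c → x ≠ v → x ≠ y → x ≠ z → x ∈ S'))) :
    clusterSquare w a b c ≤ (prodBernoulli w).real (openConn b c)ᶜ ^ 2 :=
  clusterSquare_le_sq_of_noDoubleClash_pos w a b c fun _ _ hω hη hab hac hbc hbc' =>
    not_doubleClash_of_linked H w hH hK hω hη hab hac hbc hbc'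

/-- **DUU at `(a; b, c)` under the linked criterion.** [cite: Gladkov2024, Thm. 5.2 and Thm. 4.3] -/
theorem sq_real_split_le_of_linked (hH : ∀ u v, u ≠ v → (0 : ℝ) < w s(u, v) → H.Adj u v)
    (hK : ∀ (K : Set (Fin n)) (y y' v v' : Fin n), a ∈ K → b ∉ K → c ∉ K →
      (∀ T : Set (Fin n), a ∈ T → (∀ u x, u ∈ T → H.Adj u x → x ∈ K → x ∈ T) → K ⊆ T) →
      y ∉ K → y' ∉ K → (∃ k, k ∈ K ∧ H.Adj k y) → (∃ k, k ∈ K ∧ H.Adj k y') →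
      y ≠ a → y ≠ b → y ≠ c → y' ≠ a → y' ≠ b → y' ≠ c → y ≠ y' →
      v ∉ K → v' ∉ K → v ≠ a → v ≠ b → v ≠ c → v' ≠ a → v' ≠ b → v' ≠ c → v ≠ v' → v ≠ y' → v' ≠ y →
      3 ≤ H.degree v → 3 ≤ H.degree v' →
      ∃ (S S' : Set (Fin n)) (z : Fin n),
        (v ∈ S ∧ b ∉ S ∧ ∀ u x, u ∈ S → H.Adj u x → x ∉ K → x ≠ c → x ≠ v' → x ≠ y' → x ∈ S) ∨
        (v ∈ S ∧ c ∉ S ∧ ∀ u x, u ∈ S → H.Adj u x → x ∉ K → x ≠ b → x ≠ v' → x ≠ y' → x ∈ S) ∨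
        (v' ∈ S ∧ c ∉ S ∧ ∀ u x, u ∈ S → H.Adj u x → x ∉ K → x ≠ b → x ≠ v → x ≠ y → x ∈ S) ∨
        (v' ∈ S ∧ b ∉ S ∧ ∀ u x, u ∈ S → H.Adj u x → x ∉ K → x ≠ c → x ≠ v → x ≠ y → x ∈ S) ∨
        (y ∈ S ∧ v ∉ S ∧ ∀ u x, u ∈ S → H.Adj u x → x ∉ K → x ≠ b → x ≠ c → x ≠ v' → x ≠ y' → x ∈ S) ∨
        (y' ∈ S ∧ v' ∉ S ∧ ∀ u x, u ∈ S → H.Adj u x → x ∉ K → x ≠ b → x ≠ c → x ≠ v → x ≠ y → x ∈ S) ∨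
        ((v ∈ S ∧ b ∉ S ∧ ∀ u x, u ∈ S → H.Adj u x → x ∉ K → x ≠ c → x ≠ v' → x ≠ y' → x ≠ z → x ∈ S) ∧
          (v' ∈ S' ∧ c ∉ S' ∧ ∀ u x, u ∈ S' → H.Adj u x → x ∉ K → x ≠ b → x ≠ v → x ≠ y → x ≠ z → x ∈ S')) ∨
        ((y ∈ S ∧ v ∉ S ∧ ∀ u x, u ∈ S → H.Adj u x → x ∉ K → x ≠ b → x ≠ c → x ≠ v' → x ≠ y' → x ≠ z → x ∈ S) ∧
          (v' ∈ S' ∧ c ∉ S' ∧ ∀ u x, u ∈ S' → H.Adj u x → x ∉ K → x ≠ b → x ≠ v → x ≠ y → x ≠ z → x ∈ S')) ∨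
        ((v ∈ S ∧ b ∉ S ∧ ∀ u x, u ∈ S → H.Adj u x → x ∉ K → x ≠ c → x ≠ v' → x ≠ y' → x ≠ z → x ∈ S) ∧
          (y' ∈ S' ∧ v' ∉ S' ∧ ∀ u x, u ∈ S' → H.Adj u x → x ∉ K → x ≠ b → x ≠ c → x ≠ v → x ≠ y → x ≠ z → x ∈ S')) ∨
        ((y ∈ S ∧ v ∉ S ∧ ∀ u x, u ∈ S → H.Adj u x → x ∉ K → x ≠ b → x ≠ c → x ≠ v' → x ≠ y' → x ≠ z → x ∈ S) ∧
          (y' ∈ S' ∧ v' ∉ S' ∧ ∀ u x, u ∈ S' → H.Adj u x → x ∉ K → x ≠ b → x ≠ c → x ≠ v → x ≠ y → x ≠ z → x ∈ S')) ∨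
        ((v ∈ S ∧ c ∉ S ∧ ∀ u x, u ∈ S → H.Adj u x → x ∉ K → x ≠ b → x ≠ v' → x ≠ y' → x ≠ z → x ∈ S) ∧
          (v' ∈ S' ∧ b ∉ S' ∧ ∀ u x, u ∈ S' → H.Adj u x → x ∉ K → x ≠ c → x ≠ v → x ≠ y → x ≠ z → x ∈ S'))) :
    (prodBernoulli w).real ((openConn a b)ᶜ ∩ (openConn a c)ᶜ ∩ (openConn b c)ᶜ) ^ 2 ≤
      (prodBernoulli w).real ((openConn a b)ᶜ ∩ (openConn a c)ᶜ) * (prodBernoulli w).real (openConn b c)ᶜ ^ 2 :=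
  sq_real_split_le_of_noDoubleClash_pos w a b c fun _ _ hω hη hab hac hbc hbc' =>
    not_doubleClash_of_linked H w hH hK hω hη hab hac hbc hbc'

/-- **TS for `{a, b, c}` under the linked criterion** (root `a`): `μ(a ↮ b, a ↮ c, b ↮ c)² ≤ μ(a ↮ b) μ(a ↮ c) μ(b ↮ c)`.
[cite: Gladkov2024, Thm. 5.2, Cor. 5.3 (pattern) and Thm. 4.3] -/
theorem tripleSplit_of_linked (hH : ∀ u v, u ≠ v → (0 : ℝ) < w s(u, v) → H.Adj u v)
    (hK : ∀ (K : Set (Fin n)) (y y' v v' : Fin n), a ∈ K → b ∉ K → c ∉ K →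
      (∀ T : Set (Fin n), a ∈ T → (∀ u x, u ∈ T → H.Adj u x → x ∈ K → x ∈ T) → K ⊆ T) →
      y ∉ K → y' ∉ K → (∃ k, k ∈ K ∧ H.Adj k y) → (∃ k, k ∈ K ∧ H.Adj k y') →
      y ≠ a → y ≠ b → y ≠ c → y' ≠ a → y' ≠ b → y' ≠ c → y ≠ y' →
      v ∉ K → v' ∉ K → v ≠ a → v ≠ b → v ≠ c → v' ≠ a → v' ≠ b → v' ≠ c → v ≠ v' → v ≠ y' → v' ≠ y →
      3 ≤ H.degree v → 3 ≤ H.degree v' →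
      ∃ (S S' : Set (Fin n)) (z : Fin n),
        (v ∈ S ∧ b ∉ S ∧ ∀ u x, u ∈ S → H.Adj u x → x ∉ K → x ≠ c → x ≠ v' → x ≠ y' → x ∈ S) ∨
        (v ∈ S ∧ c ∉ S ∧ ∀ u x, u ∈ S → H.Adj u x → x ∉ K → x ≠ b → x ≠ v' → x ≠ y' → x ∈ S) ∨
        (v' ∈ S ∧ c ∉ S ∧ ∀ u x, u ∈ S → H.Adj u x → x ∉ K → x ≠ b → x ≠ v → x ≠ y → x ∈ S) ∨
        (v' ∈ S ∧ b ∉ S ∧ ∀ u x, u ∈ S → H.Adj u x → x ∉ K → x ≠ c → x ≠ v → x ≠ y → x ∈ S) ∨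
        (y ∈ S ∧ v ∉ S ∧ ∀ u x, u ∈ S → H.Adj u x → x ∉ K → x ≠ b → x ≠ c → x ≠ v' → x ≠ y' → x ∈ S) ∨
        (y' ∈ S ∧ v' ∉ S ∧ ∀ u x, u ∈ S → H.Adj u x → x ∉ K → x ≠ b → x ≠ c → x ≠ v → x ≠ y → x ∈ S) ∨
        ((v ∈ S ∧ b ∉ S ∧ ∀ u x, u ∈ S → H.Adj u x → x ∉ K → x ≠ c → x ≠ v' → x ≠ y' → x ≠ z → x ∈ S) ∧
          (v' ∈ S' ∧ c ∉ S' ∧ ∀ u x, u ∈ S' → H.Adj u x → x ∉ K → x ≠ b → x ≠ v → x ≠ y → x ≠ z → x ∈ S')) ∨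
        ((y ∈ S ∧ v ∉ S ∧ ∀ u x, u ∈ S → H.Adj u x → x ∉ K → x ≠ b → x ≠ c → x ≠ v' → x ≠ y' → x ≠ z → x ∈ S) ∧
          (v' ∈ S' ∧ c ∉ S' ∧ ∀ u x, u ∈ S' → H.Adj u x → x ∉ K → x ≠ b → x ≠ v → x ≠ y → x ≠ z → x ∈ S')) ∨
        ((v ∈ S ∧ b ∉ S ∧ ∀ u x, u ∈ S → H.Adj u x → x ∉ K → x ≠ c → x ≠ v' → x ≠ y' → x ≠ z → x ∈ S) ∧
          (y' ∈ S' ∧ v' ∉ S' ∧ ∀ u x, u ∈ S' → H.Adj u x → x ∉ K → x ≠ b → x ≠ c → x ≠ v → x ≠ y → x ≠ z → x ∈ S')) ∨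
        ((y ∈ S ∧ v ∉ S ∧ ∀ u x, u ∈ S → H.Adj u x → x ∉ K → x ≠ b → x ≠ c → x ≠ v' → x ≠ y' → x ≠ z → x ∈ S) ∧
          (y' ∈ S' ∧ v' ∉ S' ∧ ∀ u x, u ∈ S' → H.Adj u x → x ∉ K → x ≠ b → x ≠ c → x ≠ v → x ≠ y → x ≠ z → x ∈ S')) ∨
        ((v ∈ S ∧ c ∉ S ∧ ∀ u x, u ∈ S → H.Adj u x → x ∉ K → x ≠ b → x ≠ v' → x ≠ y' → x ≠ z → x ∈ S) ∧
          (v' ∈ S' ∧ b ∉ S' ∧ ∀ u x, u ∈ S' → H.Adj u x → x ∉ K → x ≠ c → x ≠ v → x ≠ y → x ≠ z → x ∈ S'))) :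
    (prodBernoulli w).real ((openConn a b)ᶜ ∩ (openConn a c)ᶜ ∩ (openConn b c)ᶜ) ^ 2 ≤
      (prodBernoulli w).real (openConn a b)ᶜ * (prodBernoulli w).real (openConn a c)ᶜ *
        (prodBernoulli w).real (openConn b c)ᶜ :=
  tripleSplit_of_noDoubleClash_pos w a b c fun _ _ hω hη hab hac hbc hbc' =>
    not_doubleClash_of_linked H w hH hK hω hη hab hac hbc hbc'

end Fin

end Consts

end Summit.CriticalPhenomena.PercolationContinuityZ3.Theorems
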